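import Literature.MathematicalPhysics.QuantumLattice.TorusShellCounting
import Literature.MathematicalPhysics.QuantumLattice.TorusCooperSum

/-!
# Level counting on the square-lattice torus at the band edges: the lattice diamond below
# `μ → 0⁻` and the small square above `μ → -4⁺`

Topic `MathematicalPhysics/QuantumLattice` (family `hubbard`); companion of `TorusShellCounting.lean`
(thin shells AWAY from `{-4, 0, 4}`), written for the chemical-potential window of the support item
`TwPureThermalBound` (route `HubbardSuperconductivity/ThermalWedge`). For the free band
`ε_L(k) = -2cos(2πk₀/L) - 2cos(2πk₁/L)` (`torusBand`) we PROVE, with the folded index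
`m(a) = min(a, L - a)` of a residue `a ∈ ℤ/Lℤ` (so `cos(2πa/L) = cos(2π m(a)/L)`, `2π m(a)/L ∈ [0, π]`):

* `card_filter_foldedIndex_le`: `#{a : m(a) ≤ K} = 2K + 1` for `2K < L`;
* `torusBand_le_of_folded_sum_le`: the lattice diamond `m(k₀) + m(k₁) ≤ M` (`2M < L`) lies below
  `-4cos²(πM/L)` (sum-to-product), and `two_mul_sq_le_card_diamond`: it has `≥ 2M²` points (layer-cake
  over the fibre count; the exact number is `2M² + 2M + 1`);
* `card_filter_torusBand_lt_bottom_le`: `#{k : ε_L(k) < -4 + s} ≤ (2⌊√s L/4⌋ + 1)²` (Jordan's inequality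
  confines both folded angles to `< π√s/2`);
* explicit consequences: for `L ≥ 400`, `#{k : ε_L(k) < -cos²(49π/100)} ≥ (19/40) L²`
  (`card_filter_torusBand_lt_upperEdge`: free density `≥ 19/20` just below the band centre), and for
  `L ≥ 4`, `#{k : ε_L(k) < -15/4} ≤ L²/4` (`card_filter_torusBand_lt_lowerEdge`: free density `≤ 1/2`
  just above the band bottom).

No measure theory and no Riemann sums: only finite combinatorics of `ℤ/Lℤ`. Everything is proved; no
definition and no named fact. [folklore]
-/

noncomputable section

namespace Literature.MathematicalPhysics.QuantumLattice

open Finset Real Literature.Probability.LatticeModels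

variable {L : ℕ} [NeZero L]

/-! ### Level counting: folded coordinates, the diamond below `μ → 0⁻`, the square above `μ → -4⁺` -/

/-- **Fibre count.** For `2K < L`, the residues `a ∈ ℤ/Lℤ` at folded distance `min(a, L - a) ≤ K` from
`0` are exactly `2K + 1` in number. [folklore] -/
theorem card_filter_foldedIndex_le {K : ℕ} (hK : 2 * K < L) :
    (Finset.univ.filter fun a : ZMod L => min a.val (L - a.val) ≤ K).card = 2 * K + 1 := by
  have hval : ∀ v : ℕ, v < L → ((v : ZMod L)).val = v := fun v hv => ZMod.val_cast_of_lt hv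
  rw [Finset.card_bij (t := (Finset.range L).filter fun v => min v (L - v) ≤ K) (fun a _ => a.val)]
  · have hset : ((Finset.range L).filter fun v => min v (L - v) ≤ K) =
        Finset.range (K + 1) ∪ Finset.Ico (L - K) L := by
      ext v
      simp only [Finset.mem_filter, Finset.mem_range, Finset.mem_union, Finset.mem_Ico]
      omega
    rw [hset, Finset.card_union_of_disjoint, Finset.card_range, Nat.card_Ico]
    · omega
    · rw [Finset.disjoint_left]
      intro v hv hv'
      rw [Finset.mem_range] at hv
      rw [Finset.mem_Ico] at hv'
      omega
  · intro a ha
    rw [Finset.mem_filter] at ha ⊢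
    exact ⟨Finset.mem_range.2 (ZMod.val_lt a), ha.2⟩
  · intro a _ b _ h
    exact ZMod.val_injective L h
  · intro v hv
    rw [Finset.mem_filter, Finset.mem_range] at hv
    refine ⟨(v : ZMod L), ?_, hval v hv.1⟩
    rw [Finset.mem_filter, hval v hv.1]
    exact ⟨Finset.mem_univ _, hv.2⟩

/-- The cosine of a residue only depends on its folded index:
`cos(2π a/L) = cos(2π min(a, L-a)/L)`. [folklore] -/
theorem cos_angle_eq_cos_folded (a : ZMod L) :
    Real.cos (2 * π * (a.val : ℝ) / L) = Real.cos (2 * π * ((min a.val (L - a.val) : ℕ) : ℝ) / L) := by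
  have hL : (0 : ℝ) < L := by exact_mod_cast Nat.pos_of_ne_zero (NeZero.ne L)
  rcases le_total a.val (L - a.val) with h | h
  · rw [min_eq_left h]
  · rw [min_eq_right h]
    have hle : a.val ≤ L := (ZMod.val_lt a).le
    rw [Nat.cast_sub hle]
    have : 2 * π * ((L : ℝ) - a.val) / L = 2 * π - 2 * π * (a.val : ℝ) / L := by
      field_simp
    rw [this, Real.cos_two_pi_sub]

/-- The folded angle `2π min(a, L-a)/L` lies in `[0, π]`. [folklore] -/
theorem folded_angle_mem_Icc (a : ZMod L) :
    2 * π * ((min a.val (L - a.val) : ℕ) : ℝ) / L ∈ Set.Icc 0 π := by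
  have hL : (0 : ℝ) < L := by exact_mod_cast Nat.pos_of_ne_zero (NeZero.ne L)
  have h2 : 2 * ((min a.val (L - a.val) : ℕ) : ℝ) ≤ L := by
    have : 2 * min a.val (L - a.val) ≤ L := by
      have := (ZMod.val_lt a).le; omega
    exact_mod_cast this
  constructor
  · positivity
  · rw [div_le_iff₀ hL]
    nlinarith [Real.pi_pos]

/-- **The diamond lies below the band value `-4cos²(πM/L)`**: if the folded indices of `k` satisfy
`m₀ + m₁ ≤ M` with `2M < L`, then `ε_L(k) ≤ -4 cos²(πM/L)` (sum-to-product for `cos φ₀ + cos φ₁` with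
`φ₀ + φ₁ ≤ 2πM/L < π`). [folklore] -/
theorem torusBand_le_of_folded_sum_le {M : ℕ} (hM : 2 * M < L) (k : TorusSite 2 L)
    (hk : min (k 0).val (L - (k 0).val) + min (k 1).val (L - (k 1).val) ≤ M) :
    torusBand L k ≤ -4 * Real.cos (π * M / L) ^ 2 := by
  have hL : (0 : ℝ) < L := by exact_mod_cast Nat.pos_of_ne_zero (NeZero.ne L)
  set φ₀ : ℝ := 2 * π * ((min (k 0).val (L - (k 0).val) : ℕ) : ℝ) / L with hφ₀
  set φ₁ : ℝ := 2 * π * ((min (k 1).val (L - (k 1).val) : ℕ) : ℝ) / L with hφ₁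
  have h0 := folded_angle_mem_Icc (L := L) (k 0)
  have h1 := folded_angle_mem_Icc (L := L) (k 1)
  rw [← hφ₀] at h0
  rw [← hφ₁] at h1
  have hsum : φ₀ + φ₁ ≤ 2 * π * M / L := by
    rw [hφ₀, hφ₁, ← add_div, div_le_div_iff_of_pos_right hL]
    have : ((min (k 0).val (L - (k 0).val) : ℕ) : ℝ) + ((min (k 1).val (L - (k 1).val) : ℕ) : ℝ) ≤ M := by
      exact_mod_cast hk
    nlinarith [Real.pi_pos]
  have hML : 2 * (M : ℝ) < L := by exact_mod_cast hM
  have hΘ : 2 * π * (M : ℝ) / L < π := by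
    rw [div_lt_iff₀ hL]
    nlinarith [Real.pi_pos]
  have hΘ2 : π * (M : ℝ) / L ≤ π / 2 := by
    rw [div_le_iff₀ hL]
    nlinarith [Real.pi_pos]
  rw [torusBand_two_eq, cos_angle_eq_cos_folded, cos_angle_eq_cos_folded, ← hφ₀, ← hφ₁]
  -- `cos φ₀ + cos φ₁ = 2 cos((φ₀+φ₁)/2) cos((φ₀-φ₁)/2) ≥ 2 cos²(πM/L)`
  have hcc : Real.cos φ₀ + Real.cos φ₁ = 2 * Real.cos ((φ₀ + φ₁) / 2) * Real.cos ((φ₀ - φ₁) / 2) :=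
    Real.cos_add_cos φ₀ φ₁
  have hc : Real.cos (π * M / L) ≤ Real.cos ((φ₀ + φ₁) / 2) := by
    apply Real.cos_le_cos_of_nonneg_of_le_pi
    · linarith [h0.1, h1.1]
    · linarith [Real.pi_pos]
    · rw [div_le_iff₀ (by norm_num : (0 : ℝ) < 2)]
      calc φ₀ + φ₁ ≤ 2 * π * M / L := hsum
        _ = π * M / L * 2 := by ring
  have hc' : Real.cos (π * M / L) ≤ Real.cos ((φ₀ - φ₁) / 2) := by
    rw [← Real.cos_abs ((φ₀ - φ₁) / 2)]
    apply Real.cos_le_cos_of_nonneg_of_le_pi (abs_nonneg _)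
    · linarith [Real.pi_pos]
    · rw [abs_div, abs_two, div_le_iff₀ (by norm_num : (0 : ℝ) < 2)]
      have : |φ₀ - φ₁| ≤ φ₀ + φ₁ := abs_sub_le_of_nonneg_of_le h0.1 (by linarith [h1.1]) h1.1 (by linarith [h0.1])
      calc |φ₀ - φ₁| ≤ φ₀ + φ₁ := this
        _ ≤ 2 * π * M / L := hsum
        _ = π * M / L * 2 := by ring
  have hpos : 0 ≤ Real.cos (π * M / L) := by
    apply Real.cos_nonneg_of_neg_pi_div_two_le_of_le
    · have : 0 ≤ π * (M : ℝ) / L := by positivity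
      linarith [Real.pi_pos]
    · exact hΘ2
  have hprod : Real.cos (π * M / L) ^ 2 ≤ Real.cos ((φ₀ + φ₁) / 2) * Real.cos ((φ₀ - φ₁) / 2) := by
    rw [sq]; exact mul_le_mul hc hc' hpos (hpos.trans hc)
  nlinarith

/-- `Σ_{j<M} (2j + 1) = M²`. [folklore] -/
theorem sum_range_two_mul_add_one (M : ℕ) : ∑ j ∈ Finset.range M, (2 * j + 1) = M ^ 2 := by
  induction M with
  | zero => simp
  | succ n ih => rw [Finset.sum_range_succ, ih]; ring

/-- **Layer-cake lower bound for the lattice diamond**: for `2M < L`,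
`2M² ≤ #{k ∈ (ℤ/Lℤ)² : m(k₀) + m(k₁) ≤ M}` (`m` the folded index; the exact count is `2M² + 2M + 1`). [folklore] -/
theorem two_mul_sq_le_card_diamond {M : ℕ} (hM : 2 * M < L) :
    2 * M ^ 2 ≤ (Finset.univ.filter fun k : TorusSite 2 L =>
      min (k 0).val (L - (k 0).val) + min (k 1).val (L - (k 1).val) ≤ M).card := by
  classical
  set m : ZMod L → ℕ := fun a => min a.val (L - a.val) with hm
  have hmle : ∀ a : ZMod L, 2 * m a ≤ L := fun a => by
    have := (ZMod.val_lt a).le; simp only [hm]; omega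
  -- the count as a double sum
  have hcount : (Finset.univ.filter fun k : TorusSite 2 L => m (k 0) + m (k 1) ≤ M).card =
      ∑ a : ZMod L, (Finset.univ.filter fun b : ZMod L => m a + m b ≤ M).card := by
    rw [Finset.card_filter]
    have hsum : (∑ k : TorusSite 2 L, if m (k 0) + m (k 1) ≤ M then 1 else 0) =
        ∑ p : ZMod L × ZMod L, if m p.1 + m p.2 ≤ M then 1 else 0 :=
      Fintype.sum_equiv (finTwoArrowEquiv (ZMod L)) _ _ (fun k => rfl)
    rw [hsum, Fintype.sum_prod_type]
    refine Finset.sum_congr rfl fun a _ => ?_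
    rw [Finset.card_filter]
  -- each fibre has at least `2(M - m a)` elements
  have hfib : ∀ a : ZMod L, 2 * (M - m a) ≤ (Finset.univ.filter fun b : ZMod L => m a + m b ≤ M).card := by
    intro a
    by_cases ha : m a ≤ M
    · have hK : 2 * (M - m a) < L := by omega
      have hset : (Finset.univ.filter fun b : ZMod L => m a + m b ≤ M) =
          Finset.univ.filter fun b : ZMod L => min b.val (L - b.val) ≤ M - m a := by
        ext b
        simp only [Finset.mem_filter, Finset.mem_univ, true_and]
        show m a + m b ≤ M ↔ m b ≤ M - m a
        omega
      rw [hset, card_filter_foldedIndex_le hK]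
      omega
    · have : M - m a = 0 := by omega
      rw [this]; exact Nat.zero_le _
  -- layer cake: `Σ_a (M - m a) = Σ_{j<M} #{a : m a ≤ j} = Σ_{j<M} (2j+1) = M²`
  have hlayer : ∑ a : ZMod L, (M - m a) = M ^ 2 := by
    have h1 : ∀ a : ZMod L, M - m a = ∑ j ∈ Finset.range M, (if m a ≤ j then 1 else 0) := by
      intro a
      rw [← Finset.card_filter]
      have : ((Finset.range M).filter fun j => m a ≤ j) = Finset.Ico (m a) M := by
        ext j; simp only [Finset.mem_filter, Finset.mem_range, Finset.mem_Ico]; omega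
      rw [this, Nat.card_Ico]
    simp_rw [h1]
    rw [Finset.sum_comm]
    have h2 : ∀ j ∈ Finset.range M, ∑ a : ZMod L, (if m a ≤ j then 1 else 0) = 2 * j + 1 := by
      intro j hj
      rw [Finset.mem_range] at hj
      rw [← Finset.card_filter]
      exact card_filter_foldedIndex_le (by omega)
    rw [Finset.sum_congr rfl h2, sum_range_two_mul_add_one]
  -- assemble
  have hfin : (Finset.univ.filter fun k : TorusSite 2 L =>
      min (k 0).val (L - (k 0).val) + min (k 1).val (L - (k 1).val) ≤ M) =
      Finset.univ.filter fun k : TorusSite 2 L => m (k 0) + m (k 1) ≤ M := rfl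
  rw [hfin, hcount]
  calc 2 * M ^ 2 = ∑ a : ZMod L, 2 * (M - m a) := by rw [← Finset.mul_sum, hlayer]
    _ ≤ _ := Finset.sum_le_sum fun a _ => hfib a



/-- The diamond of folded indices `m₀ + m₁ ≤ M` (`2M < L`) lies strictly below every
`μ > -4cos²(πM/L)`: `2M² ≤ #{k : ε_L(k) < μ}`. [folklore] -/
theorem two_mul_sq_le_card_filter_torusBand_lt {M : ℕ} (hM : 2 * M < L) {μ : ℝ}
    (hμ : -4 * Real.cos (π * M / L) ^ 2 < μ) :
    2 * M ^ 2 ≤ (Finset.univ.filter fun k : TorusSite 2 L => torusBand L k < μ).card := by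
  refine (two_mul_sq_le_card_diamond hM).trans (Finset.card_le_card ?_)
  intro k hk
  rw [Finset.mem_filter] at hk ⊢
  exact ⟨hk.1, (torusBand_le_of_folded_sum_le hM k hk.2).trans_lt hμ⟩

/-- `1 - cos φ = 2 sin²(φ/2)`. [folklore] -/
theorem one_sub_cos_eq_two_mul_sin_sq_half (φ : ℝ) : 1 - Real.cos φ = 2 * Real.sin (φ / 2) ^ 2 := by
  have h := Real.cos_two_mul (φ / 2)
  rw [mul_div_cancel₀ φ two_ne_zero, Real.cos_sq'] at h
  linarith

/-- Near the band bottom only small folded indices occur: if `ε_L(k) < -4 + s` (`0 ≤ s`) then both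
folded indices of `k` are at most `√s · L/4` (Jordan's inequality `sin(φ/2) ≥ φ/π`). [folklore] -/
theorem folded_le_of_torusBand_lt {s : ℝ} (hs : 0 ≤ s) (k : TorusSite 2 L)
    (hk : torusBand L k < -4 + s) (i : Fin 2) :
    ((min (k i).val (L - (k i).val) : ℕ) : ℝ) ≤ Real.sqrt s * L / 4 := by
  have hL : (0 : ℝ) < L := by exact_mod_cast Nat.pos_of_ne_zero (NeZero.ne L)
  -- the cosine of the `i`-th folded angle exceeds `1 - s/2`
  set φ : ℝ := 2 * π * ((min (k i).val (L - (k i).val) : ℕ) : ℝ) / L with hφ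
  have hφI := folded_angle_mem_Icc (L := L) (k i)
  rw [← hφ] at hφI
  have hcos : 1 - s / 2 < Real.cos φ := by
    rw [torusBand_two_eq, cos_angle_eq_cos_folded, cos_angle_eq_cos_folded] at hk
    have h0 := Real.cos_le_one (2 * π * ((min (k 0).val (L - (k 0).val) : ℕ) : ℝ) / L)
    have h1 := Real.cos_le_one (2 * π * ((min (k 1).val (L - (k 1).val) : ℕ) : ℝ) / L)
    fin_cases i
    · show 1 - s / 2 < Real.cos (2 * π * ((min (k 0).val (L - (k 0).val) : ℕ) : ℝ) / L)
      linarith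
    · show 1 - s / 2 < Real.cos (2 * π * ((min (k 1).val (L - (k 1).val) : ℕ) : ℝ) / L)
      linarith
  -- Jordan: `(φ/π)² ≤ sin²(φ/2) = (1 - cos φ)/2 < s/4`
  have hj := Real.mul_le_sin (x := φ / 2) (by linarith [hφI.1]) (by linarith [hφI.2])
  have hj' : φ / π ≤ Real.sin (φ / 2) := by
    convert hj using 1; field_simp
  have hφπ : 0 ≤ φ / π := div_nonneg hφI.1 Real.pi_pos.le
  have hsq : (φ / π) ^ 2 < s / 4 := by
    have h1 : (φ / π) ^ 2 ≤ Real.sin (φ / 2) ^ 2 := pow_le_pow_left₀ hφπ hj' 2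
    have h2 := one_sub_cos_eq_two_mul_sin_sq_half φ
    nlinarith
  -- hence `φ/π < √s/2`, i.e. `m ≤ √s L/4`
  have hlt : φ / π < Real.sqrt s / 2 := by
    have h : (φ / π) ^ 2 < (Real.sqrt s / 2) ^ 2 := by
      rw [div_pow (Real.sqrt s), Real.sq_sqrt hs]; linarith
    exact lt_of_pow_lt_pow_left₀ 2 (by positivity) h
  have hφeq : φ / π = 2 * ((min (k i).val (L - (k i).val) : ℕ) : ℝ) / L := by
    rw [hφ]; field_simp
  rw [hφeq, div_lt_iff₀ hL] at hlt
  linarith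

/-- **The square count near the band bottom**: for `0 ≤ s < 4`,
`#{k : ε_L(k) < -4 + s} ≤ (2⌊√s L/4⌋₊ + 1)²`. [folklore] -/
theorem card_filter_torusBand_lt_bottom_le {s : ℝ} (hs : 0 ≤ s) (hs4 : s < 4) :
    (Finset.univ.filter fun k : TorusSite 2 L => torusBand L k < -4 + s).card ≤
      (2 * ⌊Real.sqrt s * L / 4⌋₊ + 1) ^ 2 := by
  classical
  have hL : (0 : ℝ) < L := by exact_mod_cast Nat.pos_of_ne_zero (NeZero.ne L)
  set K : ℕ := ⌊Real.sqrt s * L / 4⌋₊ with hK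
  have hK2 : 2 * K < L := by
    have h1 : (K : ℝ) ≤ Real.sqrt s * L / 4 := Nat.floor_le (by positivity)
    have h2 : Real.sqrt s < 2 := by
      rw [show (2 : ℝ) = Real.sqrt 4 by rw [show (4 : ℝ) = 2 ^ 2 by norm_num, Real.sqrt_sq (by norm_num)]]
      exact Real.sqrt_lt_sqrt hs hs4
    have : 2 * (K : ℝ) < L := by nlinarith
    exact_mod_cast this
  set S : Finset (ZMod L) := Finset.univ.filter fun a : ZMod L => min a.val (L - a.val) ≤ K with hSdef
  have hS : S.card = 2 * K + 1 := card_filter_foldedIndex_le hK2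
  calc (Finset.univ.filter fun k : TorusSite 2 L => torusBand L k < -4 + s).card
      ≤ (S ×ˢ S).card := by
        refine Finset.card_le_card_of_injOn (fun k => (k 0, k 1)) ?_ ?_
        · intro k hk
          rw [Finset.mem_coe, Finset.mem_filter] at hk
          rw [Finset.mem_coe, Finset.mem_product]
          have hm : ∀ i : Fin 2, min (k i).val (L - (k i).val) ≤ K := fun i =>
            Nat.le_floor (folded_le_of_torusBand_lt hs k hk.2 i)
          simp only [hSdef, Finset.mem_filter, Finset.mem_univ, true_and]
          exact ⟨hm 0, hm 1⟩
        · intro k _ k' _ h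
          simp only [Prod.mk.injEq] at h
          funext i
          fin_cases i
          · exact h.1
          · exact h.2
    _ = (2 * K + 1) ^ 2 := by rw [Finset.card_product, hS, sq]

/-! ### The two band-edge density inequalities with explicit constants -/

/-- Numerics for the upper edge: `4(49L/100 - 1)² ≥ (19/20) L²` once `L ≥ 400`. [folklore] -/
theorem upperEdge_numerics {x : ℝ} (hx : 400 ≤ x) : 19 / 20 * x ^ 2 ≤ 4 * (49 / 100 * x - 1) ^ 2 := by
  nlinarith

/-- **Density at least `19/20` just below the band centre.** For `L ≥ 400` the levels strictly below
`μ_hi := -cos²(49π/100)` number at least `(19/40) L²` (the lattice diamond `m₀ + m₁ ≤ ⌊49L/100⌋`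
lies below `-4cos²(49π/100) < μ_hi`). [folklore] -/
theorem card_filter_torusBand_lt_upperEdge (hL : 400 ≤ L) :
    19 / 40 * (L : ℝ) ^ 2 ≤
      ((Finset.univ.filter fun k : TorusSite 2 L => torusBand L k < -Real.cos (49 * π / 100) ^ 2).card : ℝ) := by
  have hLr : (400 : ℝ) ≤ L := by exact_mod_cast hL
  have hL0 : (0 : ℝ) < L := by linarith
  set M : ℕ := ⌊(49 / 100 : ℝ) * L⌋₊ with hM
  have hMle : (M : ℝ) ≤ 49 / 100 * L := Nat.floor_le (by positivity)
  have hMge : 49 / 100 * (L : ℝ) - 1 ≤ M := by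
    have := Nat.lt_floor_add_one ((49 / 100 : ℝ) * L); rw [← hM] at this; linarith
  have h2M : 2 * M < L := by
    have : 2 * (M : ℝ) < L := by nlinarith
    exact_mod_cast this
  -- `cos(πM/L) ≥ cos(49π/100) > 0`
  have hc0 : 0 < Real.cos (49 * π / 100) := by
    apply Real.cos_pos_of_mem_Ioo; constructor <;> nlinarith [Real.pi_pos]
  have hcle : Real.cos (49 * π / 100) ≤ Real.cos (π * M / L) := by
    apply Real.cos_le_cos_of_nonneg_of_le_pi (by positivity)
    · nlinarith [Real.pi_pos]
    · rw [div_le_iff₀ hL0]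
      nlinarith [Real.pi_pos]
  have hμ : -4 * Real.cos (π * M / L) ^ 2 < -Real.cos (49 * π / 100) ^ 2 := by
    have : Real.cos (49 * π / 100) ^ 2 ≤ Real.cos (π * M / L) ^ 2 := pow_le_pow_left₀ hc0.le hcle 2
    nlinarith [sq_nonneg (Real.cos (49 * π / 100)), hc0]
  have hcount := two_mul_sq_le_card_filter_torusBand_lt h2M hμ
  have hcount' : (2 * (M : ℝ) ^ 2) ≤
      ((Finset.univ.filter fun k : TorusSite 2 L => torusBand L k < -Real.cos (49 * π / 100) ^ 2).card : ℝ) := by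
    exact_mod_cast hcount
  have hnum := upperEdge_numerics hLr
  have hM0 : 0 ≤ 49 / 100 * (L : ℝ) - 1 := by linarith
  have : 4 * (49 / 100 * (L : ℝ) - 1) ^ 2 ≤ 4 * (M : ℝ) ^ 2 := by
    have := pow_le_pow_left₀ hM0 hMge 2; linarith
  linarith

/-- `μ_hi = -cos²(49π/100)` is negative. [folklore] -/
theorem upperEdge_neg : -Real.cos (49 * π / 100) ^ 2 < 0 := by
  have hc0 : 0 < Real.cos (49 * π / 100) := by
    apply Real.cos_pos_of_mem_Ioo; constructor <;> nlinarith [Real.pi_pos]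
  have := pow_pos hc0 2
  linarith

/-- **Density at most `1/2` just above the band bottom.** For `L ≥ 4` the levels strictly below
`μ_lo := -15/4` number at most `L²/4`. [folklore] -/
theorem card_filter_torusBand_lt_lowerEdge (hL : 4 ≤ L) :
    ((Finset.univ.filter fun k : TorusSite 2 L => torusBand L k < -15 / 4).card : ℝ) ≤ (L : ℝ) ^ 2 / 4 := by
  have hLr : (4 : ℝ) ≤ L := by exact_mod_cast hL
  have h := card_filter_torusBand_lt_bottom_le (L := L) (s := 1 / 4) (by norm_num) (by norm_num)
  rw [show (-4 : ℝ) + 1 / 4 = -15 / 4 by norm_num] at h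
  have hsqrt : Real.sqrt (1 / 4 : ℝ) = 1 / 2 := by
    rw [show (1 / 4 : ℝ) = (1 / 2) ^ 2 by norm_num, Real.sqrt_sq (by norm_num)]
  rw [hsqrt] at h
  have hK : (⌊(1 / 2 : ℝ) * L / 4⌋₊ : ℝ) ≤ (L : ℝ) / 8 := by
    have := Nat.floor_le (by positivity : (0 : ℝ) ≤ 1 / 2 * L / 4); linarith
  have h' : ((Finset.univ.filter fun k : TorusSite 2 L => torusBand L k < -15 / 4).card : ℝ) ≤
      ((2 * ⌊(1 / 2 : ℝ) * L / 4⌋₊ + 1 : ℕ) : ℝ) ^ 2 := by exact_mod_cast h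
  push_cast at h'
  have h0 : 0 ≤ 2 * (⌊(1 / 2 : ℝ) * L / 4⌋₊ : ℝ) + 1 := by positivity
  have h1 : 2 * (⌊(1 / 2 : ℝ) * L / 4⌋₊ : ℝ) + 1 ≤ (L : ℝ) / 2 := by linarith
  have := pow_le_pow_left₀ h0 h1 2
  nlinarith

end Literature.MathematicalPhysics.QuantumLattice

end
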